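import Literature.Analysis.FluidPDE.CompressibleEulerImplosionNearRegion
import Literature.Analysis.FluidPDE.CompressibleEulerImplosionShootingGlue
import Literature.Analysis.FluidPDE.CompressibleEulerImplosionODEMaximal
import HarnessLib

/-!
# Buckmaster–Cao-Labora–Gómez-Serrano at `γ = 5/3`: trajectories of (1.8) do not cross the branch orbit

Topic `Literature/Analysis/FluidPDE`; namespace
`Literature.Analysis.FluidPDE.BuckmasterCaolaboraGomezserrano2025.Monatomic`. Part of the
computer-assisted shooting argument for the named fact
`BuckmasterCaolaboraGomezserrano2025_thm11_monatomic` (THEOREM 1.1 of T. Buckmaster, G. Cao-Labora,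
J. Gómez-Serrano, *Smooth imploding solutions for 3D compressible fluids*, Forum Math. Pi 13 (2025)
e6, arXiv:2208.09445, at `γ = 5/3`).

In §6 of the paper the solution issued from `P₀` is compared, at the two ends `r_d < r_u` of the
shooting interval, with the smooth branch through `P_s` continued to the right: the two curves are
trajectories of the same planar autonomous system and therefore cannot cross (uniqueness), so
that the side on which the `P₀` trajectory passes the branch point near `P_s` is decided by where
the continued branch ends up far from `P_s` (Prop. 4.1 and the barriers of §4). This file proves
the abstract non-crossing statement in the form used by our certificate: `x` is a trajectory of the
desingularised field `Ĝ = (N_W D_Z, N_Z D_W)` on `[0, T]` along which `W` increases (so that its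
orbit is a graph `Z = h(W)` over `[W(x(0)), W(x(T))]`), `c` is a solution of (1.8) off the sonic
lines along which `W` decreases, crossing the two levels `W(x(0))`, `W(x(T))` at times
`ξ_A > ξ_B`. Then the differences `Z_c − h(W_c)` at `ξ_A` and at `ξ_B` cannot have strictly
opposite signs (`orbit_noCross`). Ingredients: the continuous inverse of a continuous strictly
monotone function on a compact interval; a local time change turning `c` into a `Ĝ`-trajectory
(`dξ/dψ = D_W D_Z`); local uniqueness for `Ĝ` (`ODE.eventuallyEq_of_contDiffAt`); connectedness.

[cite: BuckmasterCaolaboraGomezserrano2025, Prop. 4.1, §6 (proof of Theorem 1.1)]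
-/

noncomputable section

open Set Filter Topology Function

namespace Literature.Analysis.FluidPDE

namespace BuckmasterCaolaboraGomezserrano2025

namespace Monatomic

open ODE SonicSeries

variable {r : ℝ}

/-! ### The inverse of a continuous strictly increasing function on a compact interval -/

section Inverse

variable {f : ℝ → ℝ} {a b : ℝ}

/-- [folklore] -/
theorem invFunOn_Icc_spec (hab : a ≤ b) (hf : ContinuousOn f (Icc a b)) {w : ℝ}
    (hw : w ∈ Icc (f a) (f b)) :
    invFunOn f (Icc a b) w ∈ Icc a b ∧ f (invFunOn f (Icc a b) w) = w :=
  invFunOn_pos (intermediate_value_Icc hab hf hw)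

/-- [folklore] -/
theorem invFunOn_Icc_left (hm : StrictMonoOn f (Icc a b)) {t : ℝ} (ht : t ∈ Icc a b) :
    invFunOn f (Icc a b) (f t) = t :=
  hm.injOn.leftInvOn_invFunOn ht

/-- [folklore] -/
theorem strictMonoOn_invFunOn_Icc (hab : a ≤ b) (hf : ContinuousOn f (Icc a b))
    (hm : StrictMonoOn f (Icc a b)) : StrictMonoOn (invFunOn f (Icc a b)) (Icc (f a) (f b)) := by
  intro w₁ hw₁ w₂ hw₂ hlt
  obtain ⟨h₁, e₁⟩ := invFunOn_Icc_spec hab hf hw₁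
  obtain ⟨h₂, e₂⟩ := invFunOn_Icc_spec hab hf hw₂
  by_contra h
  have hle : invFunOn f (Icc a b) w₂ ≤ invFunOn f (Icc a b) w₁ := not_lt.mp h
  have := hm.monotoneOn h₂ h₁ hle
  rw [e₁, e₂] at this
  exact absurd hlt (not_lt.mpr this)

/-- **Continuity of the inverse.** [folklore] -/
theorem continuousOn_invFunOn_Icc (hab : a ≤ b) (hf : ContinuousOn f (Icc a b))
    (hm : StrictMonoOn f (Icc a b)) : ContinuousOn (invFunOn f (Icc a b)) (Icc (f a) (f b)) := by
  set τ := invFunOn f (Icc a b) with hτ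
  set J : Set ℝ := Icc (f a) (f b) with hJ
  have hτm : StrictMonoOn τ J := strictMonoOn_invFunOn_Icc hab hf hm
  have hfm := hm.monotoneOn
  have hfa : a ∈ Icc a b := ⟨le_rfl, hab⟩
  have hfb : b ∈ Icc a b := ⟨hab, le_rfl⟩
  intro w hw
  obtain ⟨htI, hft⟩ := invFunOn_Icc_spec hab hf hw
  set t := τ w with ht
  -- right continuity (within `Ici w`) when `w < f b`
  have hright : w < f b → ContinuousWithinAt τ (Ici w) w := by
    intro hwb
    have htb : t < b := by
      rcases eq_or_lt_of_le htI.2 with h | h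
      · exfalso; rw [h] at hft; exact hwb.ne hft.symm
      · exact h
    refine hτm.continuousWithinAt_right_of_exists_between ?_ ?_
    · exact mem_of_superset (Icc_mem_nhdsGE hwb) (Icc_subset_Icc_left hw.1)
    · intro b' hb'
      rw [← ht] at hb' ⊢
      set t' := min b' b with ht'
      have htt' : t < t' := lt_min hb' htb
      have ht'I : t' ∈ Icc a b := ⟨htI.1.trans htt'.le, min_le_right _ _⟩
      refine ⟨f t', ⟨hfm hfa ht'I ht'I.1, hfm ht'I hfb ht'I.2⟩, ?_⟩
      rw [show τ (f t') = t' from invFunOn_Icc_left hm ht'I]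
      exact ⟨htt', min_le_left _ _⟩
  -- left continuity (within `Iic w`) when `f a < w`
  have hleft : f a < w → ContinuousWithinAt τ (Iic w) w := by
    intro haw
    have hat : a < t := by
      rcases eq_or_lt_of_le htI.1 with h | h
      · exfalso; rw [← h] at hft; exact haw.ne hft
      · exact h
    refine hτm.continuousWithinAt_left_of_exists_between ?_ ?_
    · exact mem_of_superset (Icc_mem_nhdsLE haw) (Icc_subset_Icc_right hw.2)
    · intro b' hb'
      rw [← ht] at hb' ⊢
      set t' := max b' a with ht'
      have htt' : t' < t := max_lt hb' hat
      have ht'I : t' ∈ Icc a b := ⟨le_max_right _ _, htt'.le.trans htI.2⟩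
      refine ⟨f t', ⟨hfm hfa ht'I ht'I.1, hfm ht'I hfb ht'I.2⟩, ?_⟩
      rw [show τ (f t') = t' from invFunOn_Icc_left hm ht'I]
      exact ⟨le_max_left _ _, htt'⟩
  -- assemble
  have hsplit : J = (J ∩ Iic w) ∪ (J ∩ Ici w) := by
    rw [← inter_union_distrib_left, Iic_union_Ici, inter_univ]
  rw [hsplit]
  refine ContinuousWithinAt.union ?_ ?_
  · rcases eq_or_lt_of_le hw.1 with h | h
    · -- `w = f a`: the left part is the singleton `{w}`
      have : J ∩ Iic w ⊆ {w} := fun y hy => le_antisymm hy.2 (h ▸ hy.1.1)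
      exact (continuousWithinAt_singleton.mono this)
    · exact (hleft h).mono inter_subset_right
  · rcases eq_or_lt_of_le hw.2 with h | h
    · have : J ∩ Ici w ⊆ {w} := fun y hy => le_antisymm (h ▸ hy.1.2) hy.2
      exact (continuousWithinAt_singleton.mono this)
    · exact (hright h).mono inter_subset_right

end Inverse

/-! ### Local time change: solutions of (1.8) off the sonic lines are reparametrised `Ĝ`-trajectories -/

/-- Along a solution `c` of (1.8) on an open set of times where it is off the sonic lines, through
any time `ξ₀` and for any `ψ₀` there is a local reparametrisation `ϑ`, `ϑ(ψ₀) = ξ₀`,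
`ϑ′ = (D_W D_Z)(c ∘ ϑ) ≠ 0`, such that `c ∘ ϑ` solves `x′ = Ĝ(x)`.
[cite: BuckmasterCaolaboraGomezserrano2025, §1.3 (the desingularised system)] -/
theorem exists_timeChange {c : ℝ → ℝ × ℝ} {S : Set ℝ} (hS : IsOpen S)
    (hc : ∀ ξ ∈ S, HasDerivAt c (field r (c ξ)) ξ)
    (hoff : ∀ ξ ∈ S, DW (c ξ).1 (c ξ).2 ≠ 0 ∧ DZ (c ξ).1 (c ξ).2 ≠ 0) {ξ₀ : ℝ} (hξ₀ : ξ₀ ∈ S)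
    (ψ₀ : ℝ) :
    ∃ ϑ : ℝ → ℝ, ∃ ε > (0 : ℝ), ϑ ψ₀ = ξ₀ ∧ ∀ ψ ∈ Ioo (ψ₀ - ε) (ψ₀ + ε), ϑ ψ ∈ S ∧
      HasDerivAt ϑ (DW (c (ϑ ψ)).1 (c (ϑ ψ)).2 * DZ (c (ϑ ψ)).1 (c (ϑ ψ)).2) ψ ∧
      HasDerivAt (c ∘ ϑ) (Gh r (c (ϑ ψ))) ψ := by
  set κ : ℝ → ℝ := fun ξ => DW (c ξ).1 (c ξ).2 * DZ (c ξ).1 (c ξ).2 with hκ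
  have hκC : ∀ ξ ∈ S, ContDiffAt ℝ 1 κ ξ := by
    intro ξ hξ
    obtain ⟨h1, h2, -, -⟩ := smooth_of_field hS hc hoff hξ
    have h1' : ContDiffAt ℝ 1 (fun x => (c x).1) ξ := h1.of_le (mod_cast le_top)
    have h2' : ContDiffAt ℝ 1 (fun x => (c x).2) ξ := h2.of_le (mod_cast le_top)
    have hDW : ContDiffAt ℝ 1 (fun x => DW (c x).1 (c x).2) ξ := by
      unfold DW
      exact contDiffAt_const.add (((contDiffAt_const.mul h1').add h2').div_const 3)
    have hDZ : ContDiffAt ℝ 1 (fun x => DZ (c x).1 (c x).2) ξ := by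
      unfold DZ
      exact contDiffAt_const.add ((h1'.add (contDiffAt_const.mul h2')).div_const 3)
    exact hDW.mul hDZ
  obtain ⟨ϑ, ε, hε, hϑ0, hϑd, hϑS⟩ := exists_solution_mem (E := ℝ) (F := κ) hS hκC hξ₀ ψ₀
  refine ⟨ϑ, ε, hε, hϑ0, fun ψ hψ => ⟨hϑS ψ hψ, hϑd ψ hψ, ?_⟩⟩
  have hξ := hϑS ψ hψ
  have h := (hc (ϑ ψ) hξ).scomp ψ (hϑd ψ hψ)
  have e : κ (ϑ ψ) • field r (c (ϑ ψ)) = Gh r (c (ϑ ψ)) := by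
    rw [field_eq_smul_Gh (hoff _ hξ).1 (hoff _ hξ).2, smul_smul]
    simp only [hκ]
    rw [mul_inv_cancel₀ (mul_ne_zero (hoff _ hξ).1 (hoff _ hξ).2), one_smul]
  rw [e] at h
  exact h

/-! ### Non-crossing -/

/-- **The `P₀` trajectory cannot cross the branch orbit.** See the module docstring: `x` a
`Ĝ`-trajectory on `[0, T]` with `Ĝ_W > 0` on `[0, T)`; `c` a
solution of (1.8) on an open set of times `S` where it is off the sonic lines, with `W` strictly
decreasing on `[ξ_B, ξ_A] ⊆ S` from the level `W(x(T))` down to the level `W(x(0))`. Then it is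
impossible that `c` passes strictly below `x(0)` at `ξ_A` and strictly above `x(T)` at `ξ_B`, and
impossible that it passes strictly above `x(0)` at `ξ_A` and strictly below `x(T)` at `ξ_B`.
[cite: BuckmasterCaolaboraGomezserrano2025, Prop. 4.1, §6] -/
theorem orbit_noCross {x : ℝ → ℝ × ℝ} {T : ℝ} (hT : 0 < T)
    (hx : ∀ ψ ∈ Icc 0 T, HasDerivAt x (Gh r (x ψ)) ψ)
    (hprog : ∀ ψ ∈ Ico 0 T, 0 < (Gh r (x ψ)).1)
    {c : ℝ → ℝ × ℝ} {S : Set ℝ} (hS : IsOpen S)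
    (hc : ∀ ξ ∈ S, HasDerivAt c (field r (c ξ)) ξ)
    (hcoff : ∀ ξ ∈ S, DW (c ξ).1 (c ξ).2 ≠ 0 ∧ DZ (c ξ).1 (c ξ).2 ≠ 0)
    {ξA ξB : ℝ} (hξ : ξB < ξA) (hsub : Icc ξB ξA ⊆ S)
    (hanti : StrictAntiOn (fun ξ => (c ξ).1) (Icc ξB ξA))
    (hWA : (c ξA).1 = (x 0).1) (hWB : (c ξB).1 = (x T).1) :
    ¬ ((c ξA).2 < (x 0).2 ∧ (x T).2 < (c ξB).2) ∧
      ¬ ((x 0).2 < (c ξA).2 ∧ (c ξB).2 < (x T).2) := by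
  -- `W` along `x` and its inverse `τ`
  set Wx : ℝ → ℝ := fun ψ => (x ψ).1 with hWx
  have hxc : ContinuousOn x (Icc 0 T) := fun ψ hψ => (hx ψ hψ).continuousAt.continuousWithinAt
  have hWxc : ContinuousOn Wx (Icc 0 T) := continuous_fst.comp_continuousOn hxc
  have hWxd : ∀ ψ ∈ Icc 0 T, HasDerivAt Wx (Gh r (x ψ)).1 ψ := fun ψ hψ => (hx ψ hψ).fst
  have hWxm : StrictMonoOn Wx (Icc 0 T) := by
    refine strictMonoOn_of_deriv_pos (convex_Icc 0 T) hWxc fun ψ hψ => ?_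
    rw [interior_Icc] at hψ
    rw [(hWxd ψ ⟨hψ.1.le, hψ.2.le⟩).deriv]
    exact hprog ψ ⟨hψ.1.le, hψ.2⟩
  set A := Wx 0 with hA
  set B := Wx T with hB
  have hAB : A < B := hWxm ⟨le_rfl, hT.le⟩ ⟨hT.le, le_rfl⟩ hT
  set τ : ℝ → ℝ := invFunOn Wx (Icc 0 T) with hτ
  have hτspec : ∀ w ∈ Icc A B, τ w ∈ Icc 0 T ∧ Wx (τ w) = w := fun w hw =>
    invFunOn_Icc_spec hT.le hWxc hw
  have hτleft : ∀ ψ ∈ Icc 0 T, τ (Wx ψ) = ψ := fun ψ hψ => invFunOn_Icc_left hWxm hψ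
  have hτc : ContinuousOn τ (Icc A B) := continuousOn_invFunOn_Icc hT.le hWxc hWxm
  have hτA : τ A = 0 := hτleft 0 ⟨le_rfl, hT.le⟩
  have hτB : τ B = T := hτleft T ⟨hT.le, le_rfl⟩
  -- the orbit graph `h` and the comparison function `φ`
  set h : ℝ → ℝ := fun w => (x (τ w)).2 with hh
  have hhc : ContinuousOn h (Icc A B) :=
    continuous_snd.comp_continuousOn (hxc.comp hτc fun w hw => (hτspec w hw).1)
  set Wc : ℝ → ℝ := fun ξ => (c ξ).1 with hWc
  set φ : ℝ → ℝ := fun ξ => (c ξ).2 - h (Wc ξ) with hφ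
  have hcc : ContinuousOn c (Icc ξB ξA) := fun ξ hξ' =>
    (hc ξ (hsub hξ')).continuousAt.continuousWithinAt
  have hWcI : ∀ ξ ∈ Icc ξB ξA, Wc ξ ∈ Icc A B := by
    intro ξ hξ'
    have h1 : Wc ξ ≤ Wc ξB := hanti.antitoneOn ⟨le_rfl, hξ.le⟩ hξ' hξ'.1
    have h2 : Wc ξA ≤ Wc ξ := hanti.antitoneOn hξ' ⟨hξ.le, le_rfl⟩ hξ'.2
    exact ⟨by show (x 0).1 ≤ (c ξ).1; rw [← hWA]; exact h2,
      by show (c ξ).1 ≤ (x T).1; rw [← hWB]; exact h1⟩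
  have hφc : ContinuousOn φ (Icc ξB ξA) := by
    refine (continuous_snd.comp_continuousOn hcc).sub ?_
    exact hhc.comp (continuous_fst.comp_continuousOn hcc) hWcI
  have hφA : φ ξA = (c ξA).2 - (x 0).2 := by
    show (c ξA).2 - (x (τ ((c ξA).1))).2 = _
    rw [hWA, show τ (x 0).1 = 0 from hτA]
  have hφB : φ ξB = (c ξB).2 - (x T).2 := by
    show (c ξB).2 - (x (τ ((c ξB).1))).2 = _
    rw [hWB, show τ (x T).1 = T from hτB]
  -- local propagation of zeros of `φ` (uniqueness)
  have hloc : ∀ ξ₀ ∈ Ioo ξB ξA, φ ξ₀ = 0 → ∀ᶠ ξ in 𝓝 ξ₀, φ ξ = 0 := by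
    intro ξ₀ hξ₀ hφ0
    have hξ₀I : ξ₀ ∈ Icc ξB ξA := ⟨hξ₀.1.le, hξ₀.2.le⟩
    set w₀ := Wc ξ₀ with hw₀
    have hw₀I : w₀ ∈ Ioo A B := by
      have h1 : Wc ξ₀ < Wc ξB := hanti ⟨le_rfl, hξ.le⟩ hξ₀I hξ₀.1
      have h2 : Wc ξA < Wc ξ₀ := hanti hξ₀I ⟨hξ.le, le_rfl⟩ hξ₀.2
      exact ⟨by show (x 0).1 < (c ξ₀).1; rw [← hWA]; exact h2,
        by show (c ξ₀).1 < (x T).1; rw [← hWB]; exact h1⟩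
    have hw₀I' : w₀ ∈ Icc A B := ⟨hw₀I.1.le, hw₀I.2.le⟩
    set ψ₀ := τ w₀ with hψ₀
    obtain ⟨hψ₀I, hWxψ₀⟩ := hτspec w₀ hw₀I'
    have hψ₀o : ψ₀ ∈ Ioo 0 T := by
      have hτm := strictMonoOn_invFunOn_Icc hT.le hWxc hWxm
      have h1 := hτm ⟨le_rfl, hAB.le⟩ hw₀I' hw₀I.1
      have h2 := hτm hw₀I' ⟨hAB.le, le_rfl⟩ hw₀I.2
      rw [← hτ, hτA] at h1; rw [← hτ, hτB] at h2
      exact ⟨h1, h2⟩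
    -- the common point
    have hpt : x ψ₀ = c ξ₀ := by
      have e2 : (x ψ₀).2 = (c ξ₀).2 := by
        have : φ ξ₀ = (c ξ₀).2 - (x ψ₀).2 := rfl
        linarith
      exact Prod.ext hWxψ₀ e2
    -- time change of `c` at `ξ₀`, base time `ψ₀`
    obtain ⟨ϑ, ε, hε, hϑ0, hϑ⟩ := exists_timeChange hS hc hcoff (hsub hξ₀I) ψ₀
    -- local uniqueness for `Ĝ`
    have hev₀ : ∀ᶠ ψ in 𝓝 ψ₀, ψ ∈ Ioo 0 T := Filter.eventually_mem_set.2 (isOpen_Ioo.mem_nhds hψ₀o)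
    have hev₁ : ∀ᶠ ψ in 𝓝 ψ₀, HasDerivAt x (Gh r (x ψ)) ψ :=
      hev₀.mono fun ψ hψ => hx ψ ⟨hψ.1.le, hψ.2.le⟩
    have hIε : Ioo (ψ₀ - ε) (ψ₀ + ε) ∈ 𝓝 ψ₀ := isOpen_Ioo.mem_nhds ⟨by linarith, by linarith⟩
    have hev₂ : ∀ᶠ ψ in 𝓝 ψ₀, HasDerivAt (c ∘ ϑ) (Gh r ((c ∘ ϑ) ψ)) ψ :=
      Filter.mem_of_superset hIε fun ψ hψ => (hϑ ψ hψ).2.2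
    have heq : x =ᶠ[𝓝 ψ₀] c ∘ ϑ :=
      eventuallyEq_of_contDiffAt ((contDiff_Gh r).of_le le_top).contDiffAt hev₁ hev₂
        (by rw [hpt, Function.comp_apply, hϑ0])
    -- a symmetric interval `[ψ₀ - δ, ψ₀ + δ]` inside `(0,T) ∩ (ψ₀-ε, ψ₀+ε)` on which `x = c ∘ ϑ`
    obtain ⟨δ, hδ, hδsub⟩ : ∃ δ > (0 : ℝ), ∀ ψ, |ψ - ψ₀| ≤ δ →
        ψ ∈ Ioo 0 T ∧ ψ ∈ Ioo (ψ₀ - ε) (ψ₀ + ε) ∧ x ψ = c (ϑ ψ) := by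
      have hall : ∀ᶠ ψ in 𝓝 ψ₀, ψ ∈ Ioo 0 T ∧ ψ ∈ Ioo (ψ₀ - ε) (ψ₀ + ε) ∧ x ψ = c (ϑ ψ) :=
        ((hev₀.and (Filter.eventually_mem_set.2 hIε)).and heq).mono fun ψ h => ⟨h.1.1, h.1.2, h.2⟩
      obtain ⟨δ₀, hδ₀, hball⟩ := Metric.eventually_nhds_iff.mp hall
      refine ⟨δ₀ / 2, by positivity, fun ψ hψ => hball ?_⟩
      rw [Real.dist_eq]; exact lt_of_le_of_lt hψ (by linarith)
    -- `ϑ` is strictly monotone or antitone on that interval (its derivative does not vanish)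
    set I₀ : Set ℝ := Icc (ψ₀ - δ) (ψ₀ + δ) with hI₀
    have hI₀sub : ∀ ψ ∈ I₀, ψ ∈ Ioo 0 T ∧ ψ ∈ Ioo (ψ₀ - ε) (ψ₀ + ε) ∧ x ψ = c (ϑ ψ) :=
      fun ψ hψ => hδsub ψ (abs_sub_le_iff.2 ⟨by linarith [hψ.2], by linarith [hψ.1]⟩)
    have hϑd : ∀ ψ ∈ I₀, HasDerivAt ϑ (DW (c (ϑ ψ)).1 (c (ϑ ψ)).2 * DZ (c (ϑ ψ)).1 (c (ϑ ψ)).2) ψ :=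
      fun ψ hψ => (hϑ ψ (hI₀sub ψ hψ).2.1).2.1
    have hϑc : ContinuousOn ϑ I₀ := fun ψ hψ => (hϑd ψ hψ).continuousAt.continuousWithinAt
    have hϑne : ∀ ψ ∈ I₀, deriv ϑ ψ ≠ 0 := by
      intro ψ hψ
      rw [(hϑd ψ hψ).deriv]
      have hSψ := (hϑ ψ (hI₀sub ψ hψ).2.1).1
      exact mul_ne_zero (hcoff _ hSψ).1 (hcoff _ hSψ).2
    -- image of `I₀` under `ϑ` contains a neighbourhood of `ξ₀`
    have hinj : InjOn ϑ I₀ := by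
      -- a function with nonvanishing derivative on an interval is injective (Rolle)
      intro ψ₁ h₁ ψ₂ h₂ heq'
      by_contra hne
      rcases lt_or_gt_of_ne hne with hlt | hlt
      · obtain ⟨ζ, hζ, hζ0⟩ := exists_deriv_eq_zero hlt
          (hϑc.mono (Icc_subset_Icc h₁.1 h₂.2)) heq'
        exact hϑne ζ ⟨by linarith [hζ.1, h₁.1], by linarith [hζ.2, h₂.2]⟩ hζ0
      · obtain ⟨ζ, hζ, hζ0⟩ := exists_deriv_eq_zero hlt
          (hϑc.mono (Icc_subset_Icc h₂.1 h₁.2)) heq'.symm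
        exact hϑne ζ ⟨by linarith [hζ.1, h₂.1], by linarith [hζ.2, h₁.2]⟩ hζ0
    have hψ₁I : ψ₀ - δ ∈ I₀ := ⟨le_rfl, by linarith⟩
    have hψ₂I : ψ₀ + δ ∈ I₀ := ⟨by linarith, le_rfl⟩
    have hψ₀I₀ : ψ₀ ∈ I₀ := ⟨by linarith, by linarith⟩
    set ξ₁ := ϑ (ψ₀ - δ) with hξ₁
    set ξ₂ := ϑ (ψ₀ + δ) with hξ₂
    have hne₁ : ξ₁ ≠ ξ₀ := fun e => by
      have := hinj hψ₁I hψ₀I₀ (e.trans hϑ0.symm); linarith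
    have hne₂ : ξ₂ ≠ ξ₀ := fun e => by
      have := hinj hψ₂I hψ₀I₀ (e.trans hϑ0.symm); linarith
    have hne₁₂ : ξ₁ ≠ ξ₂ := fun e => by
      have := hinj hψ₁I hψ₂I e; linarith
    -- `ξ₀` lies strictly between `ξ₁` and `ξ₂`
    have hbetween : min ξ₁ ξ₂ < ξ₀ ∧ ξ₀ < max ξ₁ ξ₂ := by
      -- by the intermediate value theorem `ϑ` on `[ψ₀-δ, ψ₀]` covers `[[ξ₁, ξ₀]]`, on `[ψ₀, ψ₀+δ]`
      -- covers `[[ξ₀, ξ₂]]`; injectivity forbids `ξ₁, ξ₂` on the same side of `ξ₀`.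
      by_contra hcon
      rw [not_and_or, not_lt, not_lt] at hcon
      have hc1 : ContinuousOn ϑ (Icc (ψ₀ - δ) ψ₀) := hϑc.mono (Icc_subset_Icc le_rfl (by linarith))
      have hc2 : ContinuousOn ϑ (Icc ψ₀ (ψ₀ + δ)) := hϑc.mono (Icc_subset_Icc (by linarith) le_rfl)
      rcases hcon with hle | hle
      · -- `ξ₀ ≤ min ξ₁ ξ₂`: both `ξ₁, ξ₂ > ξ₀`
        have h1 : ξ₀ < ξ₁ := lt_of_le_of_ne ((le_min_iff.1 hle).1) hne₁.symm
        have h2 : ξ₀ < ξ₂ := lt_of_le_of_ne ((le_min_iff.1 hle).2) hne₂.symm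
        -- the value `m := min ξ₁ ξ₂` is attained on both sides
        set m := min ξ₁ ξ₂ with hm
        have hm0 : ξ₀ < m := lt_min h1 h2
        obtain ⟨s₁, hs₁, hs₁v⟩ : ∃ s ∈ Icc (ψ₀ - δ) ψ₀, ϑ s = m := by
          have := intermediate_value_Icc' (by linarith : ψ₀ - δ ≤ ψ₀) hc1
          rw [hϑ0] at this
          exact this ⟨hm0.le, min_le_left _ _⟩
        obtain ⟨s₂, hs₂, hs₂v⟩ : ∃ s ∈ Icc ψ₀ (ψ₀ + δ), ϑ s = m := by
          have := intermediate_value_Icc (by linarith : ψ₀ ≤ ψ₀ + δ) hc2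
          rw [hϑ0] at this
          exact this ⟨hm0.le, min_le_right _ _⟩
        have hs₁₀ : s₁ ≠ ψ₀ := fun e => by rw [e, hϑ0] at hs₁v; linarith
        have hs₂₀ : s₂ ≠ ψ₀ := fun e => by rw [e, hϑ0] at hs₂v; linarith
        have he := hinj ⟨hs₁.1, by linarith [hs₁.2]⟩ ⟨by linarith [hs₂.1], hs₂.2⟩ (hs₁v.trans hs₂v.symm)
        have hlt' : s₁ < s₂ := lt_of_le_of_lt hs₁.2 (lt_of_le_of_ne hs₂.1 (Ne.symm hs₂₀))
        exact absurd he hlt'.ne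
      · -- `max ξ₁ ξ₂ ≤ ξ₀`: both `ξ₁, ξ₂ < ξ₀`
        have h1 : ξ₁ < ξ₀ := lt_of_le_of_ne ((max_le_iff.1 hle).1) hne₁
        have h2 : ξ₂ < ξ₀ := lt_of_le_of_ne ((max_le_iff.1 hle).2) hne₂
        set m := max ξ₁ ξ₂ with hm
        have hm0 : m < ξ₀ := max_lt h1 h2
        obtain ⟨s₁, hs₁, hs₁v⟩ : ∃ s ∈ Icc (ψ₀ - δ) ψ₀, ϑ s = m := by
          have := intermediate_value_Icc (by linarith : ψ₀ - δ ≤ ψ₀) hc1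
          rw [hϑ0] at this
          exact this ⟨le_max_left _ _, hm0.le⟩
        obtain ⟨s₂, hs₂, hs₂v⟩ : ∃ s ∈ Icc ψ₀ (ψ₀ + δ), ϑ s = m := by
          have := intermediate_value_Icc' (by linarith : ψ₀ ≤ ψ₀ + δ) hc2
          rw [hϑ0] at this
          exact this ⟨le_max_right _ _, hm0.le⟩
        have hs₁₀ : s₁ ≠ ψ₀ := fun e => by rw [e, hϑ0] at hs₁v; linarith
        have hs₂₀ : s₂ ≠ ψ₀ := fun e => by rw [e, hϑ0] at hs₂v; linarith
        have he := hinj ⟨hs₁.1, by linarith [hs₁.2]⟩ ⟨by linarith [hs₂.1], hs₂.2⟩ (hs₁v.trans hs₂v.symm)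
        have hlt' : s₁ < s₂ := lt_of_le_of_lt hs₁.2 (lt_of_le_of_ne hs₂.1 (Ne.symm hs₂₀))
        exact absurd he hlt'.ne
    -- every `ξ` strictly between `ξ₁` and `ξ₂` is `ϑ ψ` for some `ψ ∈ I₀`
    have hcover : ∀ ξ ∈ Ioo (min ξ₁ ξ₂) (max ξ₁ ξ₂), ∃ ψ ∈ I₀, ϑ ψ = ξ := by
      intro ξ hξ'
      have huI := intermediate_value_uIcc (a := ψ₀ - δ) (b := ψ₀ + δ) (f := ϑ)
        (by rw [Set.uIcc_of_le (by linarith)]; exact hϑc)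
      have hmem : ξ ∈ uIcc ξ₁ ξ₂ := ⟨hξ'.1.le, hξ'.2.le⟩
      obtain ⟨ψ, hψ, hψv⟩ := huI hmem
      rw [Set.uIcc_of_le (by linarith)] at hψ
      exact ⟨ψ, hψ, hψv⟩
    -- conclusion of the local step
    have hnhd : Ioo (min ξ₁ ξ₂) (max ξ₁ ξ₂) ∈ 𝓝 ξ₀ := isOpen_Ioo.mem_nhds hbetween
    refine Filter.mem_of_superset hnhd fun ξ hξ' => ?_
    obtain ⟨ψ, hψI, hψv⟩ := hcover ξ hξ'
    obtain ⟨hψT, -, hxψ⟩ := hI₀sub ψ hψI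
    have hψT' : ψ ∈ Icc 0 T := ⟨hψT.1.le, hψT.2.le⟩
    -- `c ξ = x ψ`, so `τ (W_c ξ) = ψ` and `h (W_c ξ) = Z_c ξ`
    have e1 : c ξ = x ψ := by rw [← hψv, hxψ]
    show (c ξ).2 - h (Wc ξ) = 0
    have e2 : Wc ξ = Wx ψ := by simp only [hWc, hWx]; rw [e1]
    simp only [hh]
    rw [e2, hτleft ψ hψT', e1]; ring
  -- global propagation on `(ξB, ξA)` and to the endpoints
  have hzero : (∃ ξ₀ ∈ Ioo ξB ξA, φ ξ₀ = 0) → φ ξB = 0 ∧ φ ξA = 0 := by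
    rintro ⟨ξ₀, hξ₀, hφ0⟩
    set u : Set ℝ := {ξ | ξ ∈ Ioo ξB ξA ∧ ∀ᶠ ζ in 𝓝 ξ, φ ζ = 0} with hu
    have hu_open : IsOpen u := by
      rw [isOpen_iff_mem_nhds]
      rintro ξ ⟨hξI, hev⟩
      have h1 : ∀ᶠ ζ in 𝓝 ξ, ζ ∈ Ioo ξB ξA := isOpen_Ioo.mem_nhds hξI
      have h2 : ∀ᶠ ζ in 𝓝 ξ, ∀ᶠ η in 𝓝 ζ, φ η = 0 := hev.eventually_nhds
      exact (h1.and h2).mono fun ζ hζ => ⟨hζ.1, hζ.2⟩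
    have hZ : IsClosed (Icc ξB ξA ∩ φ ⁻¹' {0}) :=
      hφc.preimage_isClosed_of_isClosed isClosed_Icc isClosed_singleton
    have huZ : u ⊆ Icc ξB ξA ∩ φ ⁻¹' {0} := fun ζ hζ =>
      ⟨⟨hζ.1.1.le, hζ.1.2.le⟩, hζ.2.self_of_nhds⟩
    have hcl : closure u ∩ Ioo ξB ξA ⊆ u := by
      rintro ξ ⟨hξcl, hξI⟩
      have hφξ : φ ξ = 0 := (closure_minimal huZ hZ hξcl).2
      exact ⟨hξI, hloc ξ hξI hφξ⟩
    have hall : Ioo ξB ξA ⊆ u := isPreconnected_Ioo.subset_of_closure_inter_subset hu_open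
      ⟨ξ₀, hξ₀, hξ₀, hloc ξ₀ hξ₀ hφ0⟩ hcl
    have h1 : closure (Ioo ξB ξA) ⊆ Icc ξB ξA ∩ φ ⁻¹' {0} :=
      closure_minimal (fun ζ hζ => huZ (hall hζ)) hZ
    have hIccZ : Icc ξB ξA ⊆ Icc ξB ξA ∩ φ ⁻¹' {0} := fun ζ hζ =>
      h1 (by rw [closure_Ioo hξ.ne]; exact hζ)
    exact ⟨(hIccZ ⟨le_rfl, hξ.le⟩).2, (hIccZ ⟨hξ.le, le_rfl⟩).2⟩
  refine ⟨fun hh' => ?_, fun hh' => ?_⟩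
  · have hA' : φ ξA < 0 := by rw [hφA]; linarith [hh'.1]
    have hB' : 0 < φ ξB := by rw [hφB]; linarith [hh'.2]
    obtain ⟨ξ₀, hξ₀, hφ0⟩ : ∃ ξ₀ ∈ Ioo ξB ξA, φ ξ₀ = 0 :=
      intermediate_value_Ioo' hξ.le hφc ⟨hA', hB'⟩
    have := (hzero ⟨ξ₀, hξ₀, hφ0⟩).1
    linarith
  · have hA' : 0 < φ ξA := by rw [hφA]; linarith [hh'.1]
    have hB' : φ ξB < 0 := by rw [hφB]; linarith [hh'.2]
    obtain ⟨ξ₀, hξ₀, hφ0⟩ : ∃ ξ₀ ∈ Ioo ξB ξA, φ ξ₀ = 0 :=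
      intermediate_value_Ioo hξ.le hφc ⟨hB', hA'⟩
    have := (hzero ⟨ξ₀, hξ₀, hφ0⟩).1
    linarith

end Monatomic

end BuckmasterCaolaboraGomezserrano2025

end Literature.Analysis.FluidPDE
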